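import Literature.AlgebraicGeometry.Motives.MixedHodgeStructureEndAlgDual
import Literature.AlgebraicGeometry.Motives.MixedHodgeStructureEndAlgJordan
import Literature.AlgebraicGeometry.Motives.MixedHodgeStructureEndAlgIsoIdempotents
import Literature.LinearAlgebra.SemisimpleElementaryDivisors
import HarnessLib

/-!
# Transposition `End_MHS(H) → End_MHS(H^∨)` preserves minimal polynomials, semisimplicity, Jordan decompositions,
# isomorphism and centrality of idempotents

The dual `H^∨` of a mixed Hodge structure is an MHS and `a ↦ a^∨` is an anti-isomorphism `End_MHS(H) ≅ End_MHS(H^∨)ᵒᵖ`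
(Cattani–El Zein–Griffiths–Lê §3.2.2.7; the tree's `endAlg.transposeLinear`, `endAlg.transposeAlgEquiv`,
`Motives/MixedHodgeStructureEndAlgDual`).  Since `P(a)^∨ = P(a^∨)` for every polynomial `P`, the transpose has the same
minimal polynomial as `a`, hence is semi-simple iff `a` is (Humphreys §4.2: "`x ∈ End V` semisimple [iff] the roots of its
minimal polynomial over `F` are all distinct"; Hoffman–Kunze §7.5: `T` semisimple iff `μ_T` is a product of distinct
primes — the tree's `Literature.LinearAlgebra.isSemisimple_iff_squarefree_minpoly`), and the Jordan–Chevalley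
decomposition inside `End_MHS(H)` (`Motives/MixedHodgeStructureEndAlgJordan`) transposes to the one inside `End_MHS(H^∨)`:
**`(a^∨)_s = (a_s)^∨`, `(a^∨)_n = (a_n)^∨`, `(a^∨)_u = (a_u)^∨`, `log((a_u)^∨) = (log a_u)^∨`** (uniqueness, Humphreys
§4.2 Prop. (a), Malle–Testerman Prop. 2.2).  Isomorphism of idempotents is preserved by anti-isomorphisms (Lam (21.20),
the tree's `IsIsoIdempotent.op_iff`, `equiv_iff`), so with Example (B) for MHS
(`Motives/MixedHodgeStructureEndAlgIsoIdempotents`): **`Im e ≅ Im f` as sub-MHS of `H` iff `Im e^∨ ≅ Im f^∨` as sub-MHS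
of `H^∨`**; and `e` is central iff `e^∨` is.

Contents (namespace `Literature.AlgebraicGeometry.Motives.MixedHodgeStructure`; everything proved, no definitions, no
named facts):
* §1 `endAlg.transposeLinear_aeval` (`P(a)^∨ = P(a^∨)`), **`endAlg.minpoly_transposeLinear`** (`μ_{a^∨} = μ_a`),
  **`endAlg.isSemisimple_coe_transposeLinear_iff`**, `endAlg.isNilpotent_transposeLinear_sub_one_iff` (unipotency),
  `endAlg.mem_center_transposeLinear_iff`.
* §2 **`endAlg.jordan_add_transpose`** / `endAlg.eq_transpose_of_jordan_add` (the additive Jordan pair of `a^∨` is the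
  transpose of that of `a`), **`endAlg.jordan_mul_transpose`** / `endAlg.eq_transpose_of_jordan_mul` (multiplicative),
  `endAlg.transposeLinear_unipotentLog` (`log(u^∨) = (log u)^∨`).
* §3 idempotents: `endAlg.isIdempotentElem_transposeLinear_iff`, **`endAlg.isIsoIdempotent_transposeLinear_iff`**
  (`e^∨ ≅ f^∨ ⟺ e ≅ f`), **`endAlg.nonempty_iso_range_transpose_iff`** (`Im e^∨ ≅ Im f^∨ ⟺ Im e ≅ Im f` as MHS).

## References

* [CattaniElZeinGriffithsLe2014] E. Cattani et al. (eds.), Hodge Theory (2014), §3.2.2.7 (dual MHS), Thm. 3.2.18.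
* [Humphreys1972] J. E. Humphreys, Introduction to Lie Algebras and Representation Theory (1972), §4.2, Prop. (a), (b).
* [HoffmanKunze1971LinearAlgebra] K. Hoffman, R. Kunze, Linear Algebra, 2nd ed. (1971), §7.5 Thm. 11 and the remark
  on the transpose.
* [MalleTesterman2011] G. Malle, D. Testerman, Linear Algebraic Groups and Finite Groups of Lie Type (2011), §2.1 Prop. 2.2.
* [Lam2001FirstCourse] T. Y. Lam, A First Course in Noncommutative Rings, 2nd ed. (2001), §21 Prop. (21.20), Examples
  (B), (D).
-/

noncomputable section

namespace Literature.AlgebraicGeometry.Motives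

namespace MixedHodgeStructure

open Module Polynomial Literature.RingTheory.Idempotents
open Literature.LinearAlgebra (unipotentLog unipotentLog_eq_sum)

universe u

variable {V : Type u} [AddCommGroup V] [Module ℚ V] [FiniteDimensional ℚ V] {H : MixedHodgeStructure V}

/-! ### §1 Polynomials, minimal polynomials, semisimplicity and centrality under transposition -/

/-- **`P(a)^∨ = P(a^∨)`**: transposition, being `ℚ`-linear, unital and ANTI-multiplicative, commutes with evaluating
polynomials in one variable. [cite: HoffmanKunze1971LinearAlgebra, §7.5 (remark on the transpose)] [cite: CattaniElZeinGriffithsLe2014, §3.2.2.7] -/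
theorem endAlg.transposeLinear_aeval (a : H.endAlg) (p : ℚ[X]) :
    endAlg.transposeLinear H (aeval a p) = aeval (endAlg.transposeLinear H a) p := by
  rw [aeval_eq_sum_range, aeval_eq_sum_range, map_sum]
  refine Finset.sum_congr rfl fun k _ => ?_
  rw [map_smul, endAlg.transposeLinear_pow]

/-- **`μ_{a^∨} = μ_a`: the transpose has the same minimal polynomial** (`P(a^∨) = 0 ⟺ P(a)^∨ = 0 ⟺ P(a) = 0`,
transposition being injective). [cite: HoffmanKunze1971LinearAlgebra, §7.5 (remark on the transpose)] [cite: Humphreys1972, §4.2] -/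
theorem endAlg.minpoly_transposeLinear (a : H.endAlg) :
    minpoly ℚ (endAlg.transposeLinear H a) = minpoly ℚ a := by
  haveI : FiniteDimensional ℚ H.endAlg := finiteDimensional_endAlg H
  haveI : FiniteDimensional ℚ H.dual.endAlg := finiteDimensional_endAlg H.dual
  refine Polynomial.eq_of_monic_of_associated (minpoly.monic (Algebra.IsIntegral.isIntegral _))
    (minpoly.monic (Algebra.IsIntegral.isIntegral _)) (associated_of_dvd_dvd ?_ ?_)
  · refine minpoly.dvd ℚ _ ?_
    rw [← endAlg.transposeLinear_aeval, minpoly.aeval, map_zero]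
  · -- `(μ_{a^∨}(a))^∨ = μ_{a^∨}(a^∨) = 0`, and transposition is injective
    have h0 := minpoly.aeval ℚ (endAlg.transposeLinear H a)
    rw [← endAlg.transposeLinear_aeval] at h0
    exact minpoly.dvd ℚ a (endAlg.transposeLinear_injective H (h0.trans (map_zero _).symm))

/-- **`a^∨` is a semi-simple operator (on `V^*`) iff `a` is (on `V`)** — both have the square-free-or-not minimal
polynomial `μ_a` ("`T` is semi-simple iff `μ_T` is a product of distinct primes", the tree's
`Literature.LinearAlgebra.isSemisimple_iff_squarefree_minpoly`; cf. its `isSemisimple_dualMap_iff` for bare linear maps).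
[cite: HoffmanKunze1971LinearAlgebra, §7.5 Thm. 11 and remark] [cite: Humphreys1972, §4.2] -/
theorem endAlg.isSemisimple_coe_transposeLinear_iff (a : H.endAlg) :
    ((endAlg.transposeLinear H a : H.dual.endAlg) : Module.End ℚ (Module.Dual ℚ V)).IsSemisimple ↔
      (a : Module.End ℚ V).IsSemisimple := by
  have h1 : minpoly ℚ ((endAlg.transposeLinear H a : H.dual.endAlg) : Module.End ℚ (Module.Dual ℚ V)) =
      minpoly ℚ (endAlg.transposeLinear H a) :=
    minpoly.algHom_eq H.dual.endAlg.val Subtype.val_injective (endAlg.transposeLinear H a)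
  have h2 : minpoly ℚ (a : Module.End ℚ V) = minpoly ℚ a := minpoly.algHom_eq H.endAlg.val Subtype.val_injective a
  rw [Literature.LinearAlgebra.isSemisimple_iff_squarefree_minpoly,
    Literature.LinearAlgebra.isSemisimple_iff_squarefree_minpoly, h1, h2, endAlg.minpoly_transposeLinear]

/-- `a^∨` is unipotent iff `a` is. [cite: MalleTesterman2011, §2.1 Def. 2.1] [cite: CattaniElZeinGriffithsLe2014, §3.2.2.7] -/
theorem endAlg.isNilpotent_transposeLinear_sub_one_iff (a : H.endAlg) :
    IsNilpotent (endAlg.transposeLinear H a - 1) ↔ IsNilpotent (a - 1) := by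
  rw [← endAlg.transposeLinear_one H, ← map_sub (endAlg.transposeLinear H), endAlg.isNilpotent_transposeLinear_iff]

/-- `a^∨` and `b^∨` commute iff `a` and `b` do. [cite: CattaniElZeinGriffithsLe2014, §3.2.2.7] -/
theorem endAlg.commute_transposeLinear_iff (a b : H.endAlg) :
    Commute (endAlg.transposeLinear H a) (endAlg.transposeLinear H b) ↔ Commute a b := by
  constructor
  · intro h
    have h' := h.eq
    rw [← endAlg.transposeLinear_mul, ← endAlg.transposeLinear_mul] at h'
    exact (endAlg.transposeLinear_injective H h').symm
  · intro h
    change _ * _ = _ * _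
    rw [← endAlg.transposeLinear_mul, ← endAlg.transposeLinear_mul, h.eq]

/-- **`a^∨` is central in `End_MHS(H^∨)` iff `a` is central in `End_MHS(H)`** (transposition is a bijective
anti-homomorphism). [cite: CattaniElZeinGriffithsLe2014, §3.2.2.7] [cite: Lam2001FirstCourse, §21 Lemma (21.5)] -/
theorem endAlg.mem_center_transposeLinear_iff (a : H.endAlg) :
    endAlg.transposeLinear H a ∈ Subalgebra.center ℚ H.dual.endAlg ↔ a ∈ Subalgebra.center ℚ H.endAlg := by
  rw [Subalgebra.mem_center_iff, Subalgebra.mem_center_iff]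
  constructor
  · intro h b
    have h' := h (endAlg.transposeLinear H b)
    rw [← endAlg.transposeLinear_mul, ← endAlg.transposeLinear_mul] at h'
    exact (endAlg.transposeLinear_injective H h').symm
  · intro h c
    obtain ⟨b, rfl⟩ := endAlg.transposeLinear_surjective H c
    rw [← endAlg.transposeLinear_mul, ← endAlg.transposeLinear_mul, h b]

/-! ### §2 Jordan decompositions transpose -/

/-- **The additive Jordan decomposition transposes: if `a = a_n + a_s` in `End_MHS(H)` then
`a^∨ = (a_n)^∨ + (a_s)^∨` is a Jordan pair in `End_MHS(H^∨)`.** [cite: Humphreys1972, §4.2 Prop. (a)]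
[cite: CattaniElZeinGriffithsLe2014, §3.2.2.7] -/
theorem endAlg.jordan_add_transpose {a n s : H.endAlg} (hn : IsNilpotent n) (hs : (s : Module.End ℚ V).IsSemisimple)
    (hc : Commute n s) (h : a = n + s) :
    IsNilpotent (endAlg.transposeLinear H n) ∧
      ((endAlg.transposeLinear H s : H.dual.endAlg) : Module.End ℚ (Module.Dual ℚ V)).IsSemisimple ∧
      Commute (endAlg.transposeLinear H n) (endAlg.transposeLinear H s) ∧
      endAlg.transposeLinear H a = endAlg.transposeLinear H n + endAlg.transposeLinear H s :=
  ⟨(endAlg.isNilpotent_transposeLinear_iff H n).2 hn, (endAlg.isSemisimple_coe_transposeLinear_iff s).2 hs,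
    (endAlg.commute_transposeLinear_iff n s).2 hc, by rw [h, map_add]⟩

/-- **`(a^∨)_n = (a_n)^∨`, `(a^∨)_s = (a_s)^∨`**: every Jordan pair of `a^∨` is the transpose of the Jordan pair of `a`
(uniqueness in `End_MHS(H^∨)`). [cite: Humphreys1972, §4.2 Prop. (a)] [cite: CattaniElZeinGriffithsLe2014, §3.2.2.7] -/
theorem endAlg.eq_transpose_of_jordan_add {a n s : H.endAlg} (hn : IsNilpotent n)
    (hs : (s : Module.End ℚ V).IsSemisimple) (hc : Commute n s) (h : a = n + s) {N S : H.dual.endAlg}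
    (hN : IsNilpotent N) (hS : (S : Module.End ℚ (Module.Dual ℚ V)).IsSemisimple) (hC : Commute N S)
    (hE : endAlg.transposeLinear H a = N + S) :
    N = endAlg.transposeLinear H n ∧ S = endAlg.transposeLinear H s := by
  obtain ⟨h1, h2, h3, h4⟩ := endAlg.jordan_add_transpose hn hs hc h
  exact endAlg.isNilpotent_isSemisimple_unique hN hS h1 h2 hC h3 (hE.symm.trans h4)

/-- **The multiplicative Jordan decomposition transposes: `a^∨ = (a_s)^∨ (a_u)^∨` is a Jordan decomposition of the
automorphism `a^∨` of `H^∨`** (the factors commute, so the order reversal is harmless).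
[cite: MalleTesterman2011, §2.1 Prop. 2.2] [cite: CattaniElZeinGriffithsLe2014, §3.2.2.7] -/
theorem endAlg.jordan_mul_transpose {a s w : H.endAlg} (hs : (s : Module.End ℚ V).IsSemisimple)
    (hw : IsNilpotent (w - 1)) (hc : Commute s w) (h : a = s * w) :
    ((endAlg.transposeLinear H s : H.dual.endAlg) : Module.End ℚ (Module.Dual ℚ V)).IsSemisimple ∧
      IsNilpotent (endAlg.transposeLinear H w - 1) ∧
      Commute (endAlg.transposeLinear H s) (endAlg.transposeLinear H w) ∧
      endAlg.transposeLinear H a = endAlg.transposeLinear H s * endAlg.transposeLinear H w := by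
  refine ⟨(endAlg.isSemisimple_coe_transposeLinear_iff s).2 hs, (endAlg.isNilpotent_transposeLinear_sub_one_iff w).2 hw,
    (endAlg.commute_transposeLinear_iff s w).2 hc, ?_⟩
  rw [h, hc.eq, endAlg.transposeLinear_mul]

/-- **`(a^∨)_s = (a_s)^∨`, `(a^∨)_u = (a_u)^∨`** for an automorphism `a` of `H` (uniqueness in `End_MHS(H^∨)`).
[cite: MalleTesterman2011, §2.1 Prop. 2.2] [cite: CattaniElZeinGriffithsLe2014, §3.2.2.7] -/
theorem endAlg.eq_transpose_of_jordan_mul {a s w : H.endAlg} (ha : IsUnit a) (hs : (s : Module.End ℚ V).IsSemisimple)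
    (hw : IsNilpotent (w - 1)) (hc : Commute s w) (h : a = s * w) {S W : H.dual.endAlg}
    (hS : (S : Module.End ℚ (Module.Dual ℚ V)).IsSemisimple) (hW : IsNilpotent (W - 1)) (hC : Commute S W)
    (hE : endAlg.transposeLinear H a = S * W) :
    S = endAlg.transposeLinear H s ∧ W = endAlg.transposeLinear H w := by
  obtain ⟨h1, h2, h3, h4⟩ := endAlg.jordan_mul_transpose hs hw hc h
  exact endAlg.isSemisimple_mul_unipotent_unique ((endAlg.isUnit_transposeLinear_iff H a).2 ha) hS hW hC hE h1 h2 h3 h4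

/-- **`log(w^∨) = (log w)^∨`** for a unipotent endomorphism `w` of `H` (the logarithm is a polynomial in `w`).
[cite: MalleTesterman2011, §2.1] [cite: CattaniElZeinGriffithsLe2014, §3.2.2.7] -/
theorem endAlg.transposeLinear_unipotentLog {w : H.endAlg} (hw : IsNilpotent (w - 1)) :
    endAlg.transposeLinear H (unipotentLog w) = unipotentLog (endAlg.transposeLinear H w) := by
  obtain ⟨m, hm⟩ := hw
  have hm' : (endAlg.transposeLinear H w - 1) ^ m = 0 := by
    rw [← endAlg.transposeLinear_one H, ← map_sub (endAlg.transposeLinear H), ← endAlg.transposeLinear_pow, hm, map_zero]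
  rw [unipotentLog_eq_sum hm, unipotentLog_eq_sum hm', map_sum]
  refine Finset.sum_congr rfl fun k _ => ?_
  rw [map_smul, endAlg.transposeLinear_pow, map_sub (endAlg.transposeLinear H), endAlg.transposeLinear_one]

/-! ### §3 Idempotents under transposition -/

/-- `e^∨` is idempotent iff `e` is. [cite: Lam2001FirstCourse, §21 Prop. (21.20) Example (D)] [cite: CattaniElZeinGriffithsLe2014, §3.2.2.7] -/
theorem endAlg.isIdempotentElem_transposeLinear_iff (e : H.endAlg) :
    IsIdempotentElem (endAlg.transposeLinear H e) ↔ IsIdempotentElem e := by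
  constructor
  · intro h
    have h' := h.eq
    rw [← endAlg.transposeLinear_mul] at h'
    exact endAlg.transposeLinear_injective H h'
  · intro h
    change _ * _ = _
    rw [← endAlg.transposeLinear_mul, h.eq]

/-- **`e^∨ ≅ f^∨` in `End_MHS(H^∨)` iff `e ≅ f` in `End_MHS(H)`** (isomorphism of idempotents is preserved and reflected
by the anti-isomorphism `End_MHS(H) ≅ End_MHS(H^∨)ᵒᵖ`; Lam (21.20) Example (D), the tree's `IsIsoIdempotent.op_iff`,
`equiv_iff`). [cite: Lam2001FirstCourse, §21 Prop. (21.20) Example (D)] [cite: CattaniElZeinGriffithsLe2014, §3.2.2.7] -/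
theorem endAlg.isIsoIdempotent_transposeLinear_iff {e f : H.endAlg} :
    IsIsoIdempotent (endAlg.transposeLinear H e) (endAlg.transposeLinear H f) ↔ IsIsoIdempotent e f := by
  rw [← IsIsoIdempotent.op_iff, ← endAlg.transposeAlgEquiv_apply, ← endAlg.transposeAlgEquiv_apply,
    IsIsoIdempotent.equiv_iff]

/-- **`Im e^∨ ≅ Im f^∨` (sub-MHS of `H^∨`) iff `Im e ≅ Im f` (sub-MHS of `H`)** for idempotent endomorphisms `e, f` of `H`
(Example (B) for MHS on both sides). [cite: Lam2001FirstCourse, §21 Prop. (21.20) Examples (B), (D)]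
[cite: CattaniElZeinGriffithsLe2014, §3.2.2.7, Thm. 3.2.18] -/
theorem endAlg.nonempty_iso_range_transpose_iff {e f : H.endAlg} (he : IsIdempotentElem e) (hf : IsIdempotentElem f) :
    (∃ φ : Hom (endAlg.toHom (endAlg.transposeLinear H e)).range.toMixedHodgeStructure
        (endAlg.toHom (endAlg.transposeLinear H f)).range.toMixedHodgeStructure, Function.Bijective φ.toLinearMap) ↔
      ∃ ψ : Hom (endAlg.toHom e).range.toMixedHodgeStructure (endAlg.toHom f).range.toMixedHodgeStructure,
        Function.Bijective ψ.toLinearMap := by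
  rw [← endAlg.isIsoIdempotent_iff_nonempty_iso_range ((endAlg.isIdempotentElem_transposeLinear_iff e).2 he)
      ((endAlg.isIdempotentElem_transposeLinear_iff f).2 hf),
    ← endAlg.isIsoIdempotent_iff_nonempty_iso_range he hf, endAlg.isIsoIdempotent_transposeLinear_iff]

/-- **`e^∨` and `f^∨` are conjugate under `Aut(H^∨)` iff `e` and `f` are conjugate under `Aut(H)`** (in `End_MHS`,
isomorphic idempotents are conjugate — `Motives/MixedHodgeStructureEndAlgIsoIdempotents`). [cite: Lam2001FirstCourse, §21 Ex. 21.16]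
[cite: CattaniElZeinGriffithsLe2014, §3.2.2.7] -/
theorem endAlg.exists_units_conj_transpose_iff {e f : H.endAlg} (he : IsIdempotentElem e) (hf : IsIdempotentElem f) :
    (∃ u : (H.dual.endAlg)ˣ, endAlg.transposeLinear H f = ↑u * endAlg.transposeLinear H e * ↑u⁻¹) ↔
      ∃ u : (H.endAlg)ˣ, f = ↑u * e * ↑u⁻¹ := by
  rw [← endAlg.isIsoIdempotent_iff_exists_units_conj ((endAlg.isIdempotentElem_transposeLinear_iff e).2 he)
      ((endAlg.isIdempotentElem_transposeLinear_iff f).2 hf),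
    ← endAlg.isIsoIdempotent_iff_exists_units_conj he hf, endAlg.isIsoIdempotent_transposeLinear_iff]

end MixedHodgeStructure

end Literature.AlgebraicGeometry.Motives
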